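import Summits.Ventures.YMGap.RobustBall.WindowTiltDefect
import Summits.Ventures.YMGap.RobustBall.LocalSourceScreeningStar
import Literature.Probability.LatticeModels.DobrushinShlosmanSuperSolutionStates
import HarnessLib

/-!
# Venture YMGap, track ROBUST-BALL (Y2) — LINEAR RESPONSE THROUGH THE STAR DOOR: local sources are screened at the
# geometric rate with a constant PROPORTIONAL TO THE SOURCE'S STRENGTH (the window comparison with defects)

HONEST FRAMING. WHAT THIS IS: a venture file (cell `pub-ymgap`, track Y2 ROBUST-BALL, seat rb-p1, theorems only). The files
`LocalSourceScreeningStar[Geometric].lean` screen a local source of ANY strength with a strength-free constant (`2√N`), by declaring the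
stars that read the source UNUSABLE. This file keeps those stars usable WITH A DEFECT (`WindowTiltDefect.window_defect_le`:
`|γ^W_⋆ G(σ) − γ^{W+V}_⋆ G(σ)| ≤ min(e^{B_⋆} − 1, 2) · 2√N · Σ_{x ∈ ⋆} δ_x(G)`, `B_⋆` the window load of the source) and runs the
Literature's window comparison WITH DEFECTS (`DobrushinShlosman.abs_integral_sub_integral_le_of_window_pair_defect`, this seat) with the
two-profile super-solution `d = (2√N κ/(1−ρ)) ρ^{⌊dist(·,S)/(D+2)⌋} + 2√N ρ^{ℓ_∂}` (source part + exhaustion part; `L₀ → ∞` removes the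
latter): for every DLR `μ` of the member and EVERY DLR `ν` of `W + V`,

  `|∫ f dμ − ∫ f dν| ≤ (2√N · min(e^{B} − 1, 2)/(1 − ρ)) · ρ^{⌊d(Δ,S)/(D+2)⌋} · Σ δ`   (`abs_integral_sub_integral_le_of_source_star_defect`),

`B ≥` every star's window load — LINEAR in the source for small sources (`e^{B} − 1 ≤ B e^{B}`), never worse than the strength-free
bound up to the factor `2/(1−ρ)`, at the GEOMETRIC rate `log(1/ρ)` per `D + 2` lattice steps. WHAT THIS IS NOT: a one-sided comparison;
lattice strong coupling only, nothing about the continuum limit or a Clay-sense mass gap.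
-/

noncomputable section

open MeasureTheory ProbabilityTheory Function Finset Real
open scoped NNReal
open Literature.Probability.LatticeModels
open Literature.Probability.LatticeModels.DobrushinMetric (IsLipBound integrable_of_abs_le' abs_sub_le_mul_sum_of_dependsOn)
open Literature.MathematicalPhysics.QuantumLattice
open Literature.MathematicalPhysics.QuantumFieldTheory hiding ZdEdge Site
open Summit.Ventures.YMGap.DSWindowZd

namespace Summit.Ventures.YMGap.RobustBall

variable {d N : ℕ}

/-! ## §2 Linear response through the star door -/

/-- **LINEAR RESPONSE THROUGH THE STAR DOOR.** Member `(W, supp)`: continuous own-link terms, `ℓ^∞` range `R`, a star window bound for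
`perturbedYM (fundamentalRep (Fin N)) (N β) W supp` with locality radius `D ≥ R + 2` and received sum `0 ≤ ρ < 1`. Source `(V, suppV)`:
bounded, adapted, locally listed, terms reading only the links of the finite set `S`, with one-link oscillation witnesses `oscV` whose
WINDOW LOADS on the stars are `≤ B` (`B ≥ 0`). Then every DLR state `μ` of the member and EVERY DLR state `ν` of `W + V` satisfy, for every bounded
measurable `f` reading `Δ` with Frobenius-Lipschitz vector `δ`:
`|∫ f dμ − ∫ f dν| ≤ (2√N · min(e^B − 1, 2)/(1 − ρ)) · ρ^{⌊d(Δ,S)/(D+2)⌋} · Σ_{y ∈ Δ} δ y`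
(Literature `abs_integral_sub_integral_le_of_window_pair_defect` with the two-profile super-solution; `L₀ → ∞`). -/
theorem abs_integral_sub_integral_le_of_source_star_defect {β ρ B : ℝ} {R D : ℕ}
    {W : Potential (ZdEdge d) (SUN N)} (hWc : ∀ X, Continuous (W X))
    (hWdep : ∀ X, DependsOn (W X) (↑X : Set (ZdEdge d)))
    {supp : Finset (ZdEdge d) → Finset (Finset (ZdEdge d))} (hsupp : W.IsSupportedBy supp)
    (hR : ∀ e, ∀ X ∈ supp {e}, e ∈ X → ∀ y ∈ X, ‖e.1 - y.1‖ ≤ (R : ℝ)) (hD : R + 2 ≤ D)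
    (hρ0 : 0 ≤ ρ) (hρ1 : ρ < 1)
    (h : StarWindowBoundZdR d N (perturbedYM (d := d) (fundamentalRep (Fin N)) (N * β) W supp) D ρ
      suFrobDist)
    {V : Potential (ZdEdge d) (SUN N)} (hV : V.IsAdapted) (hVb : ∀ X, ∃ C, ∀ U, |V X U| ≤ C)
    {suppV : Finset (ZdEdge d) → Finset (Finset (ZdEdge d))} (hsuppV : V.IsSupportedBy suppV)
    {S : Finset (ZdEdge d)} (hVS : ∀ X, DependsOn (V X) (↑S : Set (ZdEdge d)))
    {oscV : Finset (ZdEdge d) → ZdEdge d → ℝ} (hoscV : ∀ X, Dobrushin.IsOscBound (V X) (oscV X))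
    (hB0 : 0 ≤ B) (hB : ∀ c : ZdEdge d, windowLoad d suppV oscV (starWinZd c) ≤ B)
    {μ ν : Measure (LGConfig d (SUN N))}
    (hμ : μ ∈ perturbedGibbsMeasures (d := d) (fundamentalRep (Fin N)) (N * β) W supp)
    (hν : ν ∈ perturbedGibbsMeasures (d := d) (fundamentalRep (Fin N)) (N * β) (W + V)
      (fun Λ => supp Λ ∪ suppV Λ))
    {f : LGConfig d (SUN N) → ℝ} (hfm : Measurable f) {Bf : ℝ} (hBf : ∀ σ, |f σ| ≤ Bf)
    {Δ : Finset (ZdEdge d)} (hfdep : DependsOn f (↑Δ : Set (ZdEdge d)))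
    {δ : ZdEdge d → ℝ} (hδ : IsLipBound suFrobDist f δ) :
    |(∫ σ, f σ ∂μ) - ∫ σ, f σ ∂ν| ≤
      2 * Real.sqrt N * min (Real.exp B - 1) 2 / (1 - ρ) * ρ ^ ⌊setDistEdges Δ S / (D + 2 : ℕ)⌋₊ * ∑ y ∈ Δ, δ y := by
  classical
  haveI : SecondCountableTopology (Matrix (Fin N) (Fin N) ℂ) :=
    inferInstanceAs (SecondCountableTopology (Fin N → Fin N → ℂ))
  haveI : SecondCountableTopology (SUN N) := Topology.IsEmbedding.subtypeVal.secondCountableTopology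
  have hW : W.IsAdapted := fun X => ⟨hWdep X, (hWc X).measurable⟩
  have hWb : ∀ X, ∃ C, ∀ U, |W X U| ≤ C := fun X => exists_bound_of_continuous (hWc X)
  have hWV : (W + V).IsAdapted := isAdapted_add hW hV
  have hWVb : ∀ X, ∃ C, ∀ U, |(W + V) X U| ≤ C := fun X => by
    obtain ⟨C₁, h₁⟩ := hWb X; obtain ⟨C₂, h₂⟩ := hVb X
    exact ⟨C₁ + C₂, fun U => (abs_add_le _ _).trans (add_le_add (h₁ U) (h₂ U))⟩
  have hγ : IsSpecification (perturbedYM (d := d) (fundamentalRep (Fin N)) (N * β) W supp) :=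
    isSpecification_perturbedYM _ (continuous_fundamentalRep (Fin N)) _ hW hWb hsupp
  have hγ' : IsSpecification (perturbedYM (d := d) (fundamentalRep (Fin N)) (N * β) (W + V)
      (fun Λ => supp Λ ∪ suppV Λ)) :=
    isSpecification_perturbedYM _ (continuous_fundamentalRep (Fin N)) _ hWV hWVb (isSupportedBy_add_union hsupp hsuppV)
  have hμ' : IsGibbsMeasure (perturbedYM (d := d) (fundamentalRep (Fin N)) (N * β) W supp) μ := hμ
  have hν' : IsGibbsMeasure (perturbedYM (d := d) (fundamentalRep (Fin N)) (N * β) (W + V)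
      (fun Λ => supp Λ ∪ suppV Λ)) ν := hν
  have hD1 : 1 ≤ D := by omega
  have hloc : ∀ (c : ZdEdge d) (ζ ζ' : LGConfig d (SUN N)), (∀ v ∈ starNbhdZdR D c.1, ζ v = ζ' v) →
      ∀ (g : LGConfig d (SUN N) → ℝ), Measurable g → (∃ B, ∀ σ, |g σ| ≤ B) →
        DependsOn g (starWinZd c : Set (ZdEdge d)) →
        ∫ σ, g σ ∂(perturbedYM (d := d) (fundamentalRep (Fin N)) (N * β) W supp (starWinZd c) ζ) =
          ∫ σ, g σ ∂(perturbedYM (d := d) (fundamentalRep (Fin N)) (N * β) W supp (starWinZd c) ζ') :=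
    fun c ζ ζ' hζ g hgm _ hgdep => perturbed_star_hloc _ (continuous_fundamentalRep (Fin N)) _
      (fun X => (hWc X).measurable) hWdep hsupp hR hD c ζ ζ' hζ g hgm hgdep
  obtain ⟨K, hK0, hKsupp, hcontract, hsum⟩ := h
  have hR₀ : (0 : ℝ) ≤ 2 * Real.sqrt N := by positivity
  -- constants
  set κ : ℝ := min (Real.exp B - 1) 2 with hκ
  have hκ0 : 0 ≤ κ := le_min (by linarith [Real.add_one_le_exp B]) (by norm_num)
  set Dc : ℝ := 2 * Real.sqrt N * κ / (1 - ρ) with hDc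
  have h1ρ : 0 < 1 - ρ := sub_pos.2 hρ1
  have hDc0 : 0 ≤ Dc := by rw [hDc]; positivity
  -- the defect array: `2√N κ` on the stars meeting `S`, `0` elsewhere
  set κarr : ZdEdge d → ZdEdge d → ℝ := fun c _ => if ∃ z ∈ starWinZd c, z ∈ S then 2 * Real.sqrt N * κ else 0 with hκarr
  have hκarr0 : ∀ c x, 0 ≤ κarr c x := fun c x => by
    simp only [hκarr]; split_ifs <;> positivity
  -- the source profile
  set ℓS : ZdEdge d → ℕ := fun x => ⌊linkSetDist S x / (D + 2 : ℕ)⌋₊ with hℓS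
  have hD2 : (0 : ℝ) < (D + 2 : ℕ) := by positivity
  have hℓS_drop : ∀ (c : ZdEdge d) x y, x ∈ starWinZd c → K c.1 y x ≠ 0 → ℓS x ≤ ℓS y + 1 := by
    intro c x y hxc hK
    have hy : y ∈ starNbhdZdR D c.1 := hKsupp _ _ _ hK
    have hyx : ‖x.1 - y.1‖ ≤ ((D + 1 : ℕ) : ℝ) := by
      refine norm_le_of_natAbs_le fun i => ?_
      have h1 := natAbs_sub_le_one_of_mem_vertexStarZd hxc i
      have h2 := (mem_starNbhdZdR.1 hy) i
      simp only [Pi.sub_apply]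
      omega
    have h1 : linkSetDist S x / (D + 2 : ℕ) ≤ linkSetDist S y / (D + 2 : ℕ) + 1 := by
      rw [div_add_one hD2.ne', div_le_div_iff_of_pos_right hD2]
      have h3 := linkSetDist_le_add_norm S x y
      have h4 : ((D + 1 : ℕ) : ℝ) ≤ ((D + 2 : ℕ) : ℝ) := by exact_mod_cast Nat.le_succ _
      linarith
    calc ℓS x ≤ ⌊linkSetDist S y / (D + 2 : ℕ) + 1⌋₊ := Nat.floor_mono h1
      _ = ℓS y + 1 := Nat.floor_add_one (div_nonneg (linkSetDist_nonneg _ _) hD2.le)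
  have hℓS_zero : ∀ (c : ZdEdge d) x, x ∈ starWinZd c → (∃ z ∈ starWinZd c, z ∈ S) → ℓS x = 0 := by
    rintro c x hxc ⟨z, hz, hzS⟩
    have hzx : ‖x.1 - z.1‖ ≤ (2 : ℕ) := by
      refine norm_le_of_natAbs_le fun i => ?_
      have h1 := natAbs_sub_le_one_of_mem_vertexStarZd hxc i
      have h2 := natAbs_sub_le_one_of_mem_vertexStarZd hz i
      simp only [Pi.sub_apply]
      omega
    have h0 : linkSetDist S z = 0 := linkSetDist_eq_zero_of_mem hzS
    have h3 := linkSetDist_le_add_norm S x z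
    refine Nat.floor_eq_zero.2 ((div_lt_one hD2).2 ?_)
    have hD' : (2 : ℝ) < ((D + 2 : ℕ) : ℝ) := by
      have : (3 : ℕ) ≤ D + 2 := by omega
      have h := (Nat.cast_le (α := ℝ)).2 this
      push_cast at h ⊢; linarith
    push_cast at hzx
    linarith
  -- for every depth `L₀`: the bound with the boundary term `R ρ^{L₀}`
  have main : ∀ L₀ : ℕ, |(∫ σ, f σ ∂μ) - ∫ σ, f σ ∂ν| ≤
      Dc * ρ ^ ⌊setDistEdges Δ S / (D + 2 : ℕ)⌋₊ * ∑ y ∈ Δ, δ y + 2 * Real.sqrt N * ρ ^ L₀ * ∑ y ∈ Δ, δ y := by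
    intro L₀
    obtain ⟨Λ, ℓ, hΔΛ, hU, hℓ, hL⟩ := exists_starExhaustionR D K hKsupp Δ L₀
    -- the super-solution `d = Dc ρ^{ℓS} + 2√N ρ^{ℓ}`
    set dsol : ZdEdge d → ℝ := fun x => Dc * ρ ^ ℓS x + 2 * Real.sqrt N * ρ ^ ℓ x with hdsol
    have key := DobrushinShlosman.abs_integral_sub_integral_le_of_window_pair_defect hγ hγ' suFrobDist_nonneg suFrobDist_le
      hR₀ (win := starWinZd) (nbhd := fun c => starNbhdZdR D c.1) (K := fun c => K c.1) (fun c y x => hK0 _ _ _)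
      (fun c => vertexStarZd_subset_starNbhdZdR hD1 c.1) (fun c y x => hKsupp _ _ _)
      hcontract hloc hρ0 hρ1 (fun c x hx => hsum c.1 x hx) hμ' hν' Λ (fun _ => True) (κ := κarr) hκarr0 ?_
      (d := dsol) (fun x => by positivity) ?_ ?_ hfm hBf hfdep hδ hΔΛ
    · refine key.trans ?_
      rw [Finset.mul_sum, Finset.mul_sum, ← Finset.sum_add_distrib]
      refine Finset.sum_le_sum fun x hx => ?_
      have hδx := hδ.nonneg x
      have h1 : ρ ^ ℓS x ≤ ρ ^ ⌊setDistEdges Δ S / (D + 2 : ℕ)⌋₊ :=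
        pow_le_pow_of_le_one hρ0 hρ1.le (Nat.floor_mono (div_le_div_of_nonneg_right (setDistEdges_le_linkSetDist hx) hD2.le))
      have h2 : ρ ^ ℓ x ≤ ρ ^ L₀ := pow_le_pow_of_le_one hρ0 hρ1.le (hL x hx)
      simp only [hdsol]
      nlinarith [mul_nonneg hDc0 hδx, mul_nonneg hR₀ hδx]
    · -- the defect of the kernels at a usable star
      intro c _ _ _ σ g hgm hgb _ δ' hδ'
      obtain ⟨Bg, hBg⟩ := hgb
      simp only [hκarr]
      by_cases hmeet : ∃ z ∈ starWinZd c, z ∈ S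
      · rw [if_pos hmeet]
        have hwd := window_defect_le (N * β) hW hWb hV hVb hsupp hsuppV hoscV (starWinZd c) σ hgm hBg hδ'
        refine hwd.trans ?_
        rw [← Finset.mul_sum]
        have hs0 : 0 ≤ ∑ x ∈ starWinZd c, δ' x := Finset.sum_nonneg fun x _ => hδ'.nonneg x
        have hmin : min (Real.exp (windowLoad d suppV oscV (starWinZd c)) - 1) 2 ≤ κ :=
          min_le_min (by linarith [Real.exp_le_exp.2 (hB c)]) le_rfl
        have h1 := mul_le_mul_of_nonneg_left hmin (mul_nonneg hR₀ hs0)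
        calc (2 * Real.sqrt N * ∑ x ∈ starWinZd c, δ' x) * min (Real.exp (windowLoad d suppV oscV (starWinZd c)) - 1) 2
            ≤ (2 * Real.sqrt N * ∑ x ∈ starWinZd c, δ' x) * κ := h1
          _ = 2 * Real.sqrt N * κ * ∑ x ∈ starWinZd c, δ' x := by ring
      · rw [if_neg hmeet]
        have hoff : ∀ A, DependsOn (V A) ((↑(starWinZd c) : Set (ZdEdge d))ᶜ) := fun A =>
          (hVS A).mono fun e heS heW => hmeet ⟨e, Finset.mem_coe.1 heW, Finset.mem_coe.1 heS⟩
        rw [perturbedYM_add_eq_of_dependsOn_compl (fundamentalRep (Fin N)) (N * β) hsupp hsuppV (fun A => (hV A).2)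
          (starWinZd c) hoff σ, sub_self, abs_zero]
        exact Finset.sum_nonneg fun x _ => mul_nonneg le_rfl (hδ'.nonneg x)
    · -- (S1)
      intro c hcΛ hcn _ x hxc
      simp only [hdsol]
      have hsumle : ∑ y ∈ starNbhdZdR D c.1, K c.1 y x ≤ ρ := hsum c.1 x hxc
      -- source part
      have hSpart : ∑ y ∈ starNbhdZdR D c.1, K c.1 y x * (Dc * ρ ^ ℓS y) + κarr c x ≤ Dc * ρ ^ ℓS x := by
        have hterm : ∀ y ∈ starNbhdZdR D c.1, K c.1 y x * (Dc * ρ ^ ℓS y) ≤ K c.1 y x * (Dc * ρ ^ (ℓS x - 1)) := by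
          intro y _
          by_cases hk0 : K c.1 y x = 0
          · rw [hk0, zero_mul, zero_mul]
          · refine mul_le_mul_of_nonneg_left (mul_le_mul_of_nonneg_left ?_ hDc0) (hK0 _ _ _)
            exact pow_le_pow_of_le_one hρ0 hρ1.le (by have := hℓS_drop c x y hxc hk0; omega)
        have hS' : ∑ y ∈ starNbhdZdR D c.1, K c.1 y x * (Dc * ρ ^ ℓS y) ≤ ρ * (Dc * ρ ^ (ℓS x - 1)) := by
          calc _ ≤ ∑ y ∈ starNbhdZdR D c.1, K c.1 y x * (Dc * ρ ^ (ℓS x - 1)) := Finset.sum_le_sum hterm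
            _ = (∑ y ∈ starNbhdZdR D c.1, K c.1 y x) * (Dc * ρ ^ (ℓS x - 1)) := by rw [Finset.sum_mul]
            _ ≤ ρ * (Dc * ρ ^ (ℓS x - 1)) := mul_le_mul_of_nonneg_right hsumle (by positivity)
        by_cases hmeet : ∃ z ∈ starWinZd c, z ∈ S
        · have h0 : ℓS x = 0 := hℓS_zero c x hxc hmeet
          simp only [hκarr, if_pos hmeet]
          rw [h0] at hS' ⊢
          simp only [Nat.zero_sub, pow_zero, mul_one] at hS' ⊢
          have hDcdef : ρ * Dc + 2 * Real.sqrt N * κ = Dc := by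
            rw [hDc]; field_simp; ring
          linarith
        · simp only [hκarr, if_neg hmeet, add_zero]
          refine hS'.trans ?_
          rcases Nat.eq_zero_or_pos (ℓS x) with h0 | hpos
          · rw [h0]; simp only [Nat.zero_sub, pow_zero, mul_one]; nlinarith
          · have : ρ * ρ ^ (ℓS x - 1) = ρ ^ ℓS x := by rw [← pow_succ']; congr 1; omega
            rw [← mul_assoc, mul_comm ρ Dc, mul_assoc, this]
      -- boundary part
      have hBpart : ∑ y ∈ starNbhdZdR D c.1, K c.1 y x * (2 * Real.sqrt N * ρ ^ ℓ y) ≤ 2 * Real.sqrt N * ρ ^ ℓ x := by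
        have hterm : ∀ y ∈ starNbhdZdR D c.1, K c.1 y x * (2 * Real.sqrt N * ρ ^ ℓ y) ≤
            K c.1 y x * (2 * Real.sqrt N * ρ ^ (ℓ x - 1)) := by
          intro y _
          by_cases hk0 : K c.1 y x = 0
          · rw [hk0, zero_mul, zero_mul]
          · refine mul_le_mul_of_nonneg_left (mul_le_mul_of_nonneg_left ?_ hR₀) (hK0 _ _ _)
            exact pow_le_pow_of_le_one hρ0 hρ1.le (by have := hℓ c x y hxc hk0; omega)
        calc _ ≤ ∑ y ∈ starNbhdZdR D c.1, K c.1 y x * (2 * Real.sqrt N * ρ ^ (ℓ x - 1)) := Finset.sum_le_sum hterm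
          _ = (∑ y ∈ starNbhdZdR D c.1, K c.1 y x) * (2 * Real.sqrt N * ρ ^ (ℓ x - 1)) := by rw [Finset.sum_mul]
          _ ≤ ρ * (2 * Real.sqrt N * ρ ^ (ℓ x - 1)) := mul_le_mul_of_nonneg_right hsumle (by positivity)
          _ ≤ 2 * Real.sqrt N * ρ ^ ℓ x := by
              rcases Nat.eq_zero_or_pos (ℓ x) with h0 | hpos
              · rw [h0]; simp only [Nat.zero_sub, pow_zero, mul_one]; nlinarith
              · have : ρ * ρ ^ (ℓ x - 1) = ρ ^ ℓ x := by rw [← pow_succ']; congr 1; omega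
                rw [← mul_assoc, mul_comm ρ (2 * Real.sqrt N), mul_assoc, this]
      have hsplit : ∑ y ∈ starNbhdZdR D c.1, K c.1 y x * (Dc * ρ ^ ℓS y + 2 * Real.sqrt N * ρ ^ ℓ y) =
          ∑ y ∈ starNbhdZdR D c.1, K c.1 y x * (Dc * ρ ^ ℓS y) +
            ∑ y ∈ starNbhdZdR D c.1, K c.1 y x * (2 * Real.sqrt N * ρ ^ ℓ y) := by
        rw [← Finset.sum_add_distrib]; exact Finset.sum_congr rfl fun y _ => by ring
      rw [hsplit]
      linarith
    · -- (S2): a site of `Λ` in no usable star has exhaustion depth `0`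
      intro x _ hx
      simp only [hdsol]
      have hx0 : ℓ x = 0 := by
        by_contra hne
        obtain ⟨hcΛ, hcn⟩ := hU x hne x (self_mem_starWinZd x)
        exact hx x hcΛ hcn trivial (self_mem_starWinZd x)
      rw [hx0, pow_zero, mul_one]
      have : 0 ≤ Dc * ρ ^ ℓS x := by positivity
      linarith
  -- `L₀ → ∞`
  have hsum0 : 0 ≤ ∑ y ∈ Δ, δ y := Finset.sum_nonneg fun y _ => hδ.nonneg y
  have hgoal : Dc * ρ ^ ⌊setDistEdges Δ S / (D + 2 : ℕ)⌋₊ * ∑ y ∈ Δ, δ y =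
      2 * Real.sqrt N * min (Real.exp B - 1) 2 / (1 - ρ) * ρ ^ ⌊setDistEdges Δ S / (D + 2 : ℕ)⌋₊ * ∑ y ∈ Δ, δ y := by
    rw [hDc]
  rw [← hgoal]
  refine le_of_forall_pos_le_add fun η hη => ?_
  obtain ⟨L₀, hL₀⟩ := exists_pow_lt_of_lt_one (show 0 < η / (2 * Real.sqrt N * ∑ y ∈ Δ, δ y + 1) by positivity) hρ1
  refine (main L₀).trans (add_le_add le_rfl ?_)
  have h1 : 2 * Real.sqrt N * ρ ^ L₀ * ∑ y ∈ Δ, δ y ≤ ρ ^ L₀ * (2 * Real.sqrt N * ∑ y ∈ Δ, δ y + 1) := by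
    have : 0 ≤ ρ ^ L₀ := pow_nonneg hρ0 L₀
    nlinarith [mul_nonneg hR₀ hsum0]
  have h2 : ρ ^ L₀ * (2 * Real.sqrt N * ∑ y ∈ Δ, δ y + 1) ≤ η := by
    have := (lt_div_iff₀ (show (0 : ℝ) < 2 * Real.sqrt N * ∑ y ∈ Δ, δ y + 1 by positivity)).1 hL₀
    linarith
  exact h1.trans h2


/-- **Exponential reading** (`ρ' = max(ρ,½)`, `ρ'^{⌊x⌋} ≤ 2 e^{−log(1/ρ') x}`; the door is monotone in `ρ`):
`|∫ f dμ − ∫ f dν| ≤ (4√N · min(e^B − 1, 2)/(1 − max(ρ,½))) · e^{−(log(1/max(ρ,½))/(D+2)) · d(Δ,S)} · Σ_{y ∈ Δ} δ y`. -/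
theorem abs_integral_sub_integral_le_of_source_star_defect_exp {β ρ B : ℝ} {R D : ℕ}
    {W : Potential (ZdEdge d) (SUN N)} (hWc : ∀ X, Continuous (W X))
    (hWdep : ∀ X, DependsOn (W X) (↑X : Set (ZdEdge d)))
    {supp : Finset (ZdEdge d) → Finset (Finset (ZdEdge d))} (hsupp : W.IsSupportedBy supp)
    (hR : ∀ e, ∀ X ∈ supp {e}, e ∈ X → ∀ y ∈ X, ‖e.1 - y.1‖ ≤ (R : ℝ)) (hD : R + 2 ≤ D) (hρ1 : ρ < 1)
    (h : StarWindowBoundZdR d N (perturbedYM (d := d) (fundamentalRep (Fin N)) (N * β) W supp) D ρ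
      suFrobDist)
    {V : Potential (ZdEdge d) (SUN N)} (hV : V.IsAdapted) (hVb : ∀ X, ∃ C, ∀ U, |V X U| ≤ C)
    {suppV : Finset (ZdEdge d) → Finset (Finset (ZdEdge d))} (hsuppV : V.IsSupportedBy suppV)
    {S : Finset (ZdEdge d)} (hVS : ∀ X, DependsOn (V X) (↑S : Set (ZdEdge d)))
    {oscV : Finset (ZdEdge d) → ZdEdge d → ℝ} (hoscV : ∀ X, Dobrushin.IsOscBound (V X) (oscV X))
    (hB0 : 0 ≤ B) (hB : ∀ c : ZdEdge d, windowLoad d suppV oscV (starWinZd c) ≤ B)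
    {μ ν : Measure (LGConfig d (SUN N))}
    (hμ : μ ∈ perturbedGibbsMeasures (d := d) (fundamentalRep (Fin N)) (N * β) W supp)
    (hν : ν ∈ perturbedGibbsMeasures (d := d) (fundamentalRep (Fin N)) (N * β) (W + V)
      (fun Λ => supp Λ ∪ suppV Λ))
    {f : LGConfig d (SUN N) → ℝ} (hfm : Measurable f) {Bf : ℝ} (hBf : ∀ σ, |f σ| ≤ Bf)
    {Δ : Finset (ZdEdge d)} (hfdep : DependsOn f (↑Δ : Set (ZdEdge d)))
    {δ : ZdEdge d → ℝ} (hδ : IsLipBound suFrobDist f δ) :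
    |(∫ σ, f σ ∂μ) - ∫ σ, f σ ∂ν| ≤ 4 * Real.sqrt N * min (Real.exp B - 1) 2 / (1 - max ρ (1 / 2)) *
      Real.exp (-(-Real.log (max ρ (1 / 2)) / (D + 2 : ℕ)) * setDistEdges Δ S) * ∑ y ∈ Δ, δ y := by
  set ρ' : ℝ := max ρ (1 / 2) with hρ'
  have hρ'h : 1 / 2 ≤ ρ' := le_max_right _ _
  have hρ'0 : 0 < ρ' := lt_of_lt_of_le (by norm_num) hρ'h
  have hρ'1 : ρ' < 1 := max_lt hρ1 (by norm_num)
  have key := abs_integral_sub_integral_le_of_source_star_defect hWc hWdep hsupp hR hD hρ'0.le hρ'1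
    (h.mono_rho (le_max_left _ _)) hV hVb hsuppV hVS hoscV hB0 hB hμ hν hfm hBf hfdep hδ
  set κ : ℝ := -Real.log ρ' with hκ
  have hκ0 : 0 ≤ κ := by rw [hκ, neg_nonneg]; exact Real.log_nonpos hρ'0.le hρ'1.le
  have hD2 : (0 : ℝ) < ((D + 2 : ℕ) : ℝ) := by positivity
  have hpow : ρ' ^ ⌊setDistEdges Δ S / (D + 2 : ℕ)⌋₊ = Real.exp (-(κ * ⌊setDistEdges Δ S / (D + 2 : ℕ)⌋₊)) := by
    rw [hκ, neg_mul, neg_neg, mul_comm, Real.exp_nat_mul, Real.exp_log hρ'0]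
  have hgeom : Real.exp (-(κ * ⌊setDistEdges Δ S / (D + 2 : ℕ)⌋₊)) ≤
      Real.exp κ * Real.exp (-(κ / (D + 2 : ℕ)) * setDistEdges Δ S) := by
    rw [← Real.exp_add]
    refine Real.exp_le_exp.2 ?_
    have hfl : setDistEdges Δ S / (D + 2 : ℕ) - 1 ≤ (⌊setDistEdges Δ S / (D + 2 : ℕ)⌋₊ : ℝ) := by
      have := Nat.lt_floor_add_one (setDistEdges Δ S / (D + 2 : ℕ))
      linarith
    have := mul_le_mul_of_nonneg_left hfl hκ0
    have e1 : -(κ / (D + 2 : ℕ)) * setDistEdges Δ S = -(κ * (setDistEdges Δ S / (D + 2 : ℕ))) := by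
      field_simp
    rw [e1]
    linarith
  have hexpκ : Real.exp κ ≤ 2 := by
    rw [hκ, Real.exp_neg, Real.exp_log hρ'0, inv_le_comm₀ hρ'0 (by norm_num : (0:ℝ) < 2)]
    linarith
  have hsum0 : 0 ≤ ∑ y ∈ Δ, δ y := Finset.sum_nonneg fun y _ => hδ.nonneg y
  have hm0 : 0 ≤ min (Real.exp B - 1) 2 := le_min (by linarith [Real.add_one_le_exp B]) (by norm_num)
  have hC0 : 0 ≤ 2 * Real.sqrt N * min (Real.exp B - 1) 2 / (1 - ρ') := by
    have : 0 < 1 - ρ' := sub_pos.2 hρ'1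
    positivity
  calc |(∫ σ, f σ ∂μ) - ∫ σ, f σ ∂ν|
        ≤ 2 * Real.sqrt N * min (Real.exp B - 1) 2 / (1 - ρ') * ρ' ^ ⌊setDistEdges Δ S / (D + 2 : ℕ)⌋₊ *
          ∑ y ∈ Δ, δ y := key
    _ = 2 * Real.sqrt N * min (Real.exp B - 1) 2 / (1 - ρ') *
          Real.exp (-(κ * ⌊setDistEdges Δ S / (D + 2 : ℕ)⌋₊)) * ∑ y ∈ Δ, δ y := by rw [hpow]
    _ ≤ 2 * Real.sqrt N * min (Real.exp B - 1) 2 / (1 - ρ') *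
          (Real.exp κ * Real.exp (-(κ / (D + 2 : ℕ)) * setDistEdges Δ S)) * ∑ y ∈ Δ, δ y := by gcongr
    _ ≤ 2 * Real.sqrt N * min (Real.exp B - 1) 2 / (1 - ρ') *
          (2 * Real.exp (-(κ / (D + 2 : ℕ)) * setDistEdges Δ S)) * ∑ y ∈ Δ, δ y := by gcongr
    _ = 4 * Real.sqrt N * min (Real.exp B - 1) 2 / (1 - ρ') *
          Real.exp (-(κ / (D + 2 : ℕ)) * setDistEdges Δ S) * ∑ y ∈ Δ, δ y := by ring

/-- **Lipschitz-cylinder reading** (`Σ δ = #Λ_F · K_F`):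
`|∫ F dμ − ∫ F dν| ≤ (4√N · min(e^B − 1, 2)/(1 − max(ρ,½))) · e^{−(log(1/max(ρ,½))/(D+2)) · d(Λ,S)} · #Λ · K_F`. -/
theorem abs_integral_sub_integral_le_of_source_star_defect_cylinder {β ρ B : ℝ} {R D : ℕ}
    {W : Potential (ZdEdge d) (SUN N)} (hWc : ∀ X, Continuous (W X))
    (hWdep : ∀ X, DependsOn (W X) (↑X : Set (ZdEdge d)))
    {supp : Finset (ZdEdge d) → Finset (Finset (ZdEdge d))} (hsupp : W.IsSupportedBy supp)
    (hR : ∀ e, ∀ X ∈ supp {e}, e ∈ X → ∀ y ∈ X, ‖e.1 - y.1‖ ≤ (R : ℝ)) (hD : R + 2 ≤ D) (hρ1 : ρ < 1)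
    (h : StarWindowBoundZdR d N (perturbedYM (d := d) (fundamentalRep (Fin N)) (N * β) W supp) D ρ
      suFrobDist)
    {V : Potential (ZdEdge d) (SUN N)} (hV : V.IsAdapted) (hVb : ∀ X, ∃ C, ∀ U, |V X U| ≤ C)
    {suppV : Finset (ZdEdge d) → Finset (Finset (ZdEdge d))} (hsuppV : V.IsSupportedBy suppV)
    {S : Finset (ZdEdge d)} (hVS : ∀ X, DependsOn (V X) (↑S : Set (ZdEdge d)))
    {oscV : Finset (ZdEdge d) → ZdEdge d → ℝ} (hoscV : ∀ X, Dobrushin.IsOscBound (V X) (oscV X))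
    (hB0 : 0 ≤ B) (hB : ∀ c : ZdEdge d, windowLoad d suppV oscV (starWinZd c) ≤ B)
    {μ ν : Measure (LGConfig d (SUN N))}
    (hμ : μ ∈ perturbedGibbsMeasures (d := d) (fundamentalRep (Fin N)) (N * β) W supp)
    (hν : ν ∈ perturbedGibbsMeasures (d := d) (fundamentalRep (Fin N)) (N * β) (W + V)
      (fun Λ => supp Λ ∪ suppV Λ))
    {F : LGConfig d (SUN N) → ℝ} {Λ : Finset (ZdEdge d)} {KF : ℝ≥0}
    (hF : IsLipschitzCylinder (fundamentalRep (Fin N)) F Λ KF) :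
    |(∫ σ, F σ ∂μ) - ∫ σ, F σ ∂ν| ≤ 4 * Real.sqrt N * min (Real.exp B - 1) 2 / (1 - max ρ (1 / 2)) *
      Real.exp (-(-Real.log (max ρ (1 / 2)) / (D + 2 : ℕ)) * setDistEdges Λ S) * (Λ.card * KF) := by
  classical
  have hA : ∀ a b : SUN N, dist (suEntries a) (suEntries b) ≤ 1 * suFrobDist a b :=
    fun a b => by rw [one_mul]; exact dist_suEntries_le_suFrobDist a b
  have key := abs_integral_sub_integral_le_of_source_star_defect_exp hWc hWdep hsupp hR hD hρ1 h hV hVb hsuppV hVS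
    hoscV hB0 hB hμ hν hF.measurable hF.abs_le hF.dependsOn (hF.isLipBound zero_le_one hA)
  have hsum : ∑ y ∈ Λ, (if y ∈ Λ then (1 : ℝ) * (KF : ℝ) else 0) = Λ.card * KF := by
    rw [Finset.sum_ite_of_true (fun y hy => hy), Finset.sum_const, nsmul_eq_mul, one_mul]
  rw [hsum] at key
  exact key

end Summit.Ventures.YMGap.RobustBall

end
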